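import Literature.NumberTheory.Transcendental.NesterenkoUResultantHeight
import Literature.NumberTheory.Transcendental.NesterenkoSkewSpecialize
import Literature.NumberTheory.Transcendental.NesterenkoEliminationProp413Proofs
import Literature.NumberTheory.Transcendental.NesterenkoEliminationCor410Proofs
import HarnessLib

/-!
# Values of the `u`-resultant (towards LNM 1752 Ch. 3 Prop. 4.11 3), route B)

`Literature/NumberTheory/Transcendental/NesterenkoUResultantValue.lean`.

## I. The estimate at generic points

The archimedean local estimate behind part 3) of Proposition 4.11, at a point `z = zOf ω t` (the
hyperplanes `zᵢ = S⁽ⁱ⁾(t) ω̄` through `ω̄`, `|t| ≤ 1`) whose coordinates together with those of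
`ω̄` are algebraically independent over `ℚ`, so that the splitting
`F(z; x̲) = ĉ ∏ᵢ (β̂⁽ⁱ⁾ · x̲)`, `G(z) = ĉ^d ∏ᵢ Q₀(β̂⁽ⁱ⁾)`, `β̂⁽ⁱ⁾ ∈ V(𝔭)`
(`exists_split_complexSpec`) is available. Writing `A = |ĉ| ∏ |β̂⁽ⁱ⁾|`,
`δᵢ = ‖ω̄ − β̂⁽ⁱ⁾‖` (projective distance, so `δᵢ ≥ ρ(ω̄)`), `D = deg 𝔭`:

* `|q|^D |G(z)| = |Q|^D A^d ∏ᵢ ‖Q‖_{β̂⁽ⁱ⁾}` (`Q = q Q₀`);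
* `A ≤ A_max(ω̄) = e^{mD} #supp F |F| ((m+1)|ω̄|)^{(s+1)D}` (Gelfond for the linear forms,
  `prod_norm_le_exp_mul_maxNorm_prod_lin`, and `|F(z; ·)| ≤ #supp F |F| M^{(s+1)D}`);
* `(∏ δᵢ) |ω̄|^D A ≤ B₀(ω̄) |𝔭(ω̄)|`, `B₀ = e^{nD} (m+1)^{(s+1)D} #supp F |F| |ω̄|^{(s+1)D}`,
  `n = m(m+1)/2`: specialise the first `s` groups of skew variables of `ϰ_ω̄(F)` at `t`
  (`blockSpec_kappa`), split `F(z; S ω̄) = ĉ ∏ ℓᵢ` with `|ℓᵢ| ≥ δᵢ |ω̄| |β̂⁽ⁱ⁾|`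
  (`projDist_mul_le_maxNorm_aeval_lam_linC`), Gelfond in the `n` skew variables;
* `‖Q‖_{β̂} ≤ 2^d (‖Q‖_ω̄ + d #supp Q · ‖ω̄ − β̂‖)` (`normAt_le_of_projDist`).

Hence (`uResultant_value_dichotomy`) for every `θ > 0`: if `θ ≤ δᵢ` for all `i` (in particular
if `θ ≤ ρ(ω̄)`) then `θ^D |ω̄|^D |q|^D |G(z)| ≤ condBound`, and otherwise
`|q|^D |G(z)| ≤ smallBound`; `condBound ∝ |𝔭(ω̄)|`, `smallBound ∝ (‖Q‖_ω̄ + d #supp Q θ)`.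

## II. From generic points to every `ω̄` with `|ω̄| = 1`

* `ϰ` is polynomial in `ω̄` (`map_kappaU`), so `|𝔭(ω̄)|`, `‖Q‖_ω̄`, `condBound`, `smallBound`
  are continuous on `ω̄ ≠ 0`;
* closed inequalities between continuous functions pass from the generic points of an open set
  to its closure (`le_of_forall_generic_of_isOpen`);
* `ρ` is lower semicontinuous quantitatively: `ρ(ω̄₀)|ω̄₀| ≤ ρ(ω̄)|ω̄| + 2|ω̄ − ω̄₀|`
  (`rho_mul_norm_le`), which keeps the condition `θ ≤ ρ(ω̄)` open;
* at a point `t` of the unit torus maximising `|ϰ_ω̄(G)(t)| ≥ |ϰ_ω̄(G)|` this gives, after the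
  case distinction `ρ < ‖Q‖_ω̄` (Cor. 4.10: `|𝔭(ω̄)| ≤ ρ e^{5m² deg 𝔭}`) / `ρ ≥ ‖Q‖_ω̄ > 0`
  (`θ ↑ ρ`) / `ρ = ‖Q‖_ω̄ = 0` (`θ ↓ 0`), the bound
  `|q|^D |ϰ_ω̄(G)| ≤ δ · valueConst` (`norm_mul_maxNorm_kappa_uResultant_le`), `δ = bezoutDelta`.

Definitions are real-valued bookkeeping constants with bodies (`archConst`, `skewConst`,
`condBound`, `smallBound`, `valueConst`), the universal `ϰ` (`skewEntryU`, `kappaU`) and the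
projections `tPart`, `ωPart`; no named facts.

## References

* [NesterenkoPhilippon2001] Yu. V. Nesterenko, P. Philippon (eds.), *Introduction to Algebraic
  Independence Theory*, LNM 1752, Springer 2001, Ch. 3 §4, Prop. 4.11 (pp. 40–41), Cor. 4.10.
* [BombieriGubler2006] E. Bombieri, W. Gubler, *Heights in Diophantine Geometry*, CUP 2006, §1.6,
  Lemma 1.6.11 (Gelfond's inequality).
-/

noncomputable section

open MvPolynomial Filter Topology
open Literature.NumberTheory.Transcendental.PhilipponMain
open scoped Pointwise

attribute [local instance] MvPolynomial.gradedAlgebra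

namespace Literature.NumberTheory.Transcendental

namespace Nesterenko

variable {m : ℕ}

/-! ### Values of forms -/

/-- `|Q(β̄)| ≤ #supp Q · |Q| · |β̄|^d` for a form of degree `d` with rational coefficients.
[folklore] -/
theorem norm_aeval_le_card_mul_maxNorm_mul_pow {Q : Rx m} {d : ℕ} (hQ : Q.IsHomogeneous d)
    (β : Fin (m + 1) → ℂ) : ‖aeval β Q‖ ≤ Q.support.card * maxNorm Q * ‖β‖ ^ d := by
  rw [aeval_def, eval₂_eq']
  calc ‖∑ e ∈ Q.support, algebraMap ℚ ℂ (coeff e Q) * ∏ i, β i ^ e i‖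
      ≤ ∑ e ∈ Q.support, ‖algebraMap ℚ ℂ (coeff e Q) * ∏ i, β i ^ e i‖ := norm_sum_le _ _
    _ ≤ ∑ _e ∈ Q.support, maxNorm Q * ‖β‖ ^ d := Finset.sum_le_sum fun e he => by
        rw [norm_mul, norm_prod]
        refine mul_le_mul ?_ ?_ (by positivity) (maxNorm_nonneg _)
        · rw [eq_ratCast, Complex.norm_ratCast, ← Real.norm_eq_abs, Rat.norm_cast_real]
          exact norm_coeff_le_maxNorm Q e
        · have hsd : ∑ i, e i = d := by
            have h := hQ (mem_support_iff.1 he)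
            rw [Finsupp.weight_apply, Finsupp.sum_fintype _ _ (fun i => by simp)] at h
            simpa using h
          calc ∏ i, ‖β i ^ e i‖ = ∏ i, ‖β i‖ ^ e i := by simp only [norm_pow]
            _ ≤ ∏ i, ‖β‖ ^ e i := Finset.prod_le_prod (fun i _ => by positivity)
                fun i _ => pow_le_pow_left₀ (norm_nonneg _) (norm_le_pi_norm β i) _
            _ = ‖β‖ ^ d := by rw [Finset.prod_pow_eq_pow_sum, hsd]
    _ = Q.support.card * maxNorm Q * ‖β‖ ^ d := by rw [Finset.sum_const, nsmul_eq_mul]; ring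

/-- `‖Q‖_β̄ ≤ #supp Q`. [folklore] -/
theorem normAt_le_card_support {Q : Rx m} {d : ℕ} (hQ : Q.IsHomogeneous d) (hQ0 : Q ≠ 0)
    (β : Fin (m + 1) → ℂ) : normAt β Q ≤ Q.support.card := by
  unfold normAt
  rw [hQ.totalDegree hQ0]
  by_cases h0 : maxNorm Q * ‖β‖ ^ d = 0
  · rw [h0, div_zero]; exact Nat.cast_nonneg _
  · rw [div_le_iff₀ (lt_of_le_of_ne (mul_nonneg (maxNorm_nonneg _) (by positivity)) (Ne.symm h0))]
    calc ‖aeval β Q‖ ≤ Q.support.card * maxNorm Q * ‖β‖ ^ d :=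
          norm_aeval_le_card_mul_maxNorm_mul_pow hQ β
      _ = Q.support.card * (maxNorm Q * ‖β‖ ^ d) := by ring

/-- **`‖Q‖_{cβ̄} = ‖Q‖_β̄`**: the normalised value only depends on the point of `ℙ_m`. [folklore] -/
theorem normAt_smul {Q : Rx m} {d : ℕ} (hQ : Q.IsHomogeneous d) (hQ0 : Q ≠ 0) {c : ℂ} (hc : c ≠ 0)
    (β : Fin (m + 1) → ℂ) : normAt (c • β) Q = normAt β Q := by
  unfold normAt
  rw [hQ.totalDegree hQ0, aeval_smul_of_isHomogeneous' hQ c β, norm_mul, norm_pow, norm_smul,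
    mul_pow, mul_left_comm (maxNorm Q),
    mul_div_mul_left _ _ (pow_ne_zero _ (norm_ne_zero_iff.mpr hc))]

/-- `|Q(ω̄)| = ‖Q‖_ω̄ · |Q| · |ω̄|^d`. [folklore] -/
theorem norm_aeval_eq_normAt_mul {Q : Rx m} {d : ℕ} (hQ : Q.IsHomogeneous d) (hQ0 : Q ≠ 0)
    {ω : Fin (m + 1) → ℂ} (hω : ω ≠ 0) :
    ‖aeval ω Q‖ = normAt ω Q * (maxNorm Q * ‖ω‖ ^ d) := by
  unfold normAt
  rw [hQ.totalDegree hQ0, div_mul_cancel₀]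
  exact mul_ne_zero (maxNorm_pos hQ0).ne' (pow_ne_zero _ (norm_ne_zero_iff.mpr hω))

/-- **`‖Q‖_β̄ ≤ 2^d (‖Q‖_ω̄ + d · #supp Q · ‖ω̄ − β̄‖)`.** If `‖ω̄ − β̄‖ ≤ ½`, rescale `β̄` to
`β̄'` with `|β̄'| ≤ |ω̄|`, `max |ωᵢ − β'ᵢ| ≤ ‖ω̄ − β̄‖ |ω̄|` (`exists_rep_near`), so `|β̄'| ≥ |ω̄|/2`
and `|Q(β̄')| ≤ |Q(ω̄)| + #supp Q |Q| d ‖ω̄ − β̄‖ |ω̄|^d`; otherwise use `‖Q‖_β̄ ≤ #supp Q`.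
[cite: NesterenkoPhilippon2001, Ch. 3 Prop. 4.11 (pp. 40–41)] -/
theorem normAt_le_of_projDist {Q : Rx m} {d : ℕ} (hQ : Q.IsHomogeneous d) (hQ0 : Q ≠ 0)
    (hd : 1 ≤ d) {ω β : Fin (m + 1) → ℂ} (hω : ω ≠ 0) (hβ : β ≠ 0) :
    normAt β Q ≤ 2 ^ d * (normAt ω Q + d * Q.support.card * projDist ω β) := by
  have hδ0 := projDist_nonneg ω β
  have hN0 := normAt_nonneg ω Q
  have hω0 : 0 < ‖ω‖ := norm_pos_iff.mpr hω
  have h2d : (2 : ℝ) ≤ 2 ^ d := by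
    calc (2 : ℝ) = 2 ^ 1 := (pow_one _).symm
      _ ≤ 2 ^ d := pow_le_pow_right₀ (by norm_num) hd
  have hc0 : (0 : ℝ) ≤ Q.support.card := Nat.cast_nonneg _
  have hd' : (1 : ℝ) ≤ d := by exact_mod_cast hd
  have hX : 0 ≤ (d : ℝ) * Q.support.card * projDist ω β := mul_nonneg (by positivity) hδ0
  by_cases hlarge : 1 / 2 < projDist ω β
  · calc normAt β Q ≤ Q.support.card := normAt_le_card_support hQ hQ0 β
      _ = Q.support.card * 1 := (mul_one _).symm
      _ ≤ Q.support.card * (2 * projDist ω β) := mul_le_mul_of_nonneg_left (by linarith) hc0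
      _ ≤ Q.support.card * (2 * projDist ω β) * d :=
          le_mul_of_one_le_right (mul_nonneg hc0 (by linarith)) hd'
      _ = 2 * (d * Q.support.card * projDist ω β) := by ring
      _ ≤ 2 ^ d * (d * Q.support.card * projDist ω β) := mul_le_mul_of_nonneg_right h2d hX
      _ ≤ 2 ^ d * (normAt ω Q + d * Q.support.card * projDist ω β) :=
          mul_le_mul_of_nonneg_left (le_add_of_nonneg_left hN0) (by positivity)
  · push Not at hlarge
    obtain ⟨c, hc1, hc2⟩ := exists_rep_near hω hβ
    have hc : c ≠ 0 := by
      rintro rfl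
      obtain ⟨k, hk⟩ := exists_norm_apply_eq_norm ω
      have h := hc2 k
      rw [zero_smul, Pi.zero_apply, sub_zero, hk] at h
      nlinarith
    have hnorm : ‖ω‖ ≤ 2 * ‖c • β‖ := by
      have h1 : ‖ω - c • β‖ ≤ projDist ω β * ‖ω‖ :=
        (pi_norm_le_iff_of_nonneg (by positivity)).mpr fun k => by simpa using hc2 k
      have h2 := norm_sub_norm_le ω (c • β)
      nlinarith
    rw [← normAt_smul hQ hQ0 hc β]
    have hdiff := norm_aeval_sub_aeval_le Q hQ ω (c • β) hω0.le
      (by positivity : 0 ≤ projDist ω β * ‖ω‖) (fun i => norm_le_pi_norm ω i) hc1 hc2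
    have hval : ‖aeval (c • β) Q‖ ≤
        maxNorm Q * ‖ω‖ ^ d * (normAt ω Q + d * Q.support.card * projDist ω β) := by
      have e1 := norm_aeval_eq_normAt_mul hQ hQ0 hω
      have e2 : (d : ℝ) * (projDist ω β * ‖ω‖) * ‖ω‖ ^ (d - 1) = d * projDist ω β * ‖ω‖ ^ d := by
        rw [← pow_sub_one_mul (by omega : d ≠ 0) ‖ω‖]; ring
      calc ‖aeval (c • β) Q‖ ≤ ‖aeval ω Q‖ + ‖aeval ω Q - aeval (c • β) Q‖ := by
            have := norm_sub_le (aeval ω Q) (aeval ω Q - aeval (c • β) Q)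
            rwa [sub_sub_cancel] at this
        _ ≤ normAt ω Q * (maxNorm Q * ‖ω‖ ^ d) +
              Q.support.card * maxNorm Q * (d * (projDist ω β * ‖ω‖) * ‖ω‖ ^ (d - 1)) :=
            add_le_add e1.le hdiff
        _ = maxNorm Q * ‖ω‖ ^ d * (normAt ω Q + d * Q.support.card * projDist ω β) := by
            rw [e2]; ring
    have hcβ0 : c • β ≠ 0 := smul_ne_zero hc hβ
    have hcβ : 0 < ‖c • β‖ := norm_pos_iff.mpr hcβ0
    have hden : 0 < maxNorm Q * ‖c • β‖ ^ d := mul_pos (maxNorm_pos hQ0) (pow_pos hcβ _)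
    have hpow : ‖ω‖ ^ d ≤ 2 ^ d * ‖c • β‖ ^ d := by
      rw [← mul_pow]; exact pow_le_pow_left₀ hω0.le hnorm d
    refine le_of_mul_le_mul_right ?_ hden
    rw [← norm_aeval_eq_normAt_mul hQ hQ0 hcβ0]
    calc ‖aeval (c • β) Q‖
        ≤ maxNorm Q * ‖ω‖ ^ d * (normAt ω Q + d * Q.support.card * projDist ω β) := hval
      _ ≤ maxNorm Q * (2 ^ d * ‖c • β‖ ^ d) *
            (normAt ω Q + d * Q.support.card * projDist ω β) :=
          mul_le_mul_of_nonneg_right (mul_le_mul_of_nonneg_left hpow (maxNorm_nonneg _))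
            (add_nonneg hN0 hX)
      _ = 2 ^ d * (normAt ω Q + d * Q.support.card * projDist ω β) *
            (maxNorm Q * ‖c • β‖ ^ d) := by ring

/-! ### Values of polynomials on polydiscs of radius `M ≥ 1` -/

/-- `|P(w)| ≤ #supp P · |P| · M^N` when `|wᵢ| ≤ M`, `M ≥ 1`, and every monomial of `P` has degree
`≤ N`. [folklore] -/
theorem norm_eval_le_card_mul_maxNorm_mul_pow {ι : Type*} [Fintype ι] (P : MvPolynomial ι ℂ)
    {w : ι → ℂ} {M : ℝ} {N : ℕ} (hM : 1 ≤ M) (hw : ∀ p, ‖w p‖ ≤ M)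
    (hN : ∀ e ∈ P.support, e.degree ≤ N) : ‖eval w P‖ ≤ P.support.card * maxNorm P * M ^ N := by
  rw [eval_eq']
  calc ‖∑ e ∈ P.support, P.coeff e * ∏ i, w i ^ e i‖
      ≤ ∑ e ∈ P.support, ‖P.coeff e * ∏ i, w i ^ e i‖ := norm_sum_le _ _
    _ ≤ ∑ _e ∈ P.support, maxNorm P * M ^ N := Finset.sum_le_sum fun e he => by
        rw [norm_mul, norm_prod]
        refine mul_le_mul (norm_coeff_le_maxNorm P e) ?_ (by positivity) (maxNorm_nonneg _)
        calc ∏ i, ‖w i ^ e i‖ = ∏ i, ‖w i‖ ^ e i := by simp only [norm_pow]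
          _ ≤ ∏ i, M ^ e i := Finset.prod_le_prod (fun i _ => by positivity)
              fun i _ => pow_le_pow_left₀ (norm_nonneg _) (hw i) _
          _ = M ^ e.degree := by rw [Finset.prod_pow_eq_pow_sum, Finsupp.degree_eq_sum]
          _ ≤ M ^ N := pow_le_pow_right₀ hM (hN e he)
    _ = P.support.card * maxNorm P * M ^ N := by rw [Finset.sum_const, nsmul_eq_mul]; ring

/-- **`|F(z; ·)| ≤ #supp F · |F| · M^N`** when `|z_w| ≤ M`, `M ≥ 1` and every monomial of `F`
has degree `≤ N` (the coefficients of `F(z; ·)` are dominated by a value of `F` at a point of the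
polydisc, `exists_eval_ge_maxNorm`). [folklore] -/
theorem maxNorm_map_aeval_splitLast_le_pow {s : ℕ} (F : RU (s + 1) m)
    {z : Fin s × Fin (m + 1) → ℂ} {M : ℝ} {N : ℕ} (hM : 1 ≤ M) (hz : ∀ w, ‖z w‖ ≤ M)
    (hN : ∀ e ∈ F.support, e.degree ≤ N) :
    maxNorm (MvPolynomial.map ((aeval z : RU s m →ₐ[ℚ] ℂ) : RU s m →+* ℂ) (splitLast s m F)) ≤
      F.support.card * maxNorm F * M ^ N := by
  classical
  set P := MvPolynomial.map ((aeval z : RU s m →ₐ[ℚ] ℂ) : RU s m →+* ℂ) (splitLast s m F) with hP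
  obtain ⟨v, hv, hle⟩ := exists_eval_ge_maxNorm P
  refine hle.trans ?_
  rw [hP, eval_map_splitLast, aeval_eq_eval_map]
  have hw : ∀ w, ‖lastCombine (fun w => (aeval z : RU s m →ₐ[ℚ] ℂ) (X w)) v w‖ ≤ M := by
    rintro ⟨i, j⟩
    induction i using Fin.lastCases with
    | last => rw [lastCombine_last, hv j]; exact hM
    | cast i => rw [lastCombine_castSucc, aeval_X]; exact hz (i, j)
  have hN' : ∀ e ∈ (MvPolynomial.map (algebraMap ℚ ℂ) F).support, e.degree ≤ N := fun e he =>
    hN e (support_map_subset _ _ he)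
  refine (norm_eval_le_card_mul_maxNorm_mul_pow _ hM hw hN').trans ?_
  rw [maxNorm_map_algebraMap_rat]
  refine mul_le_mul_of_nonneg_right ?_ (by positivity)
  refine mul_le_mul_of_nonneg_right ?_ (maxNorm_nonneg _)
  exact_mod_cast Finset.card_le_card (support_map_subset _ F)

/-! ### The bounds -/

section Bounds

variable (𝔭 : Ideal (Rx m)) (s : ℕ)

/-- `A_max(ω̄) = e^{m D} · #supp F · |F| · ((m+1)|ω̄|)^{(s+1)D}`, the bound for
`A = |ĉ| ∏ |β̂⁽ⁱ⁾|` at the hyperplanes `zOf ω t`, `|t| ≤ 1` (`F` the associated form of `𝔭` of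
index `s + 1`, `D = deg 𝔭`). [cite: NesterenkoPhilippon2001, Ch. 3 Prop. 4.11 (pp. 40–41)] -/
def archConst (ω : Fin (m + 1) → ℂ) : ℝ :=
  Real.exp ((m : ℝ) * ideg 𝔭 (s + 1)) * (chowForm 𝔭 (s + 1)).support.card *
    maxNorm (chowForm 𝔭 (s + 1)) * (((m : ℝ) + 1) * ‖ω‖) ^ ((s + 1) * ideg 𝔭 (s + 1))

/-- `B₀(ω̄) = e^{n D} (m+1)^{(s+1)D} · #supp F · |F| · |ω̄|^{(s+1)D}`, `n = #skew variables`, the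
bound for `(∏ δᵢ) |ω̄|^D A / |𝔭(ω̄)|`. [cite: NesterenkoPhilippon2001, Ch. 3 Prop. 4.11 (pp. 40–41)] -/
def skewConst (ω : Fin (m + 1) → ℂ) : ℝ :=
  Real.exp ((Fintype.card (SkewIdx m) : ℝ) * ideg 𝔭 (s + 1)) *
    ((m : ℝ) + 1) ^ ((s + 1) * ideg 𝔭 (s + 1)) * (chowForm 𝔭 (s + 1)).support.card *
    maxNorm (chowForm 𝔭 (s + 1)) * ‖ω‖ ^ ((s + 1) * ideg 𝔭 (s + 1))

/-- The right-hand side of the conditional estimate (all `δᵢ ≥ θ`):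
`|Q|^D 2^{dD} (‖Q‖_ω̄ + d #supp Q θ)^D A_max^{d−1} B₀ |𝔭(ω̄)|`.
[cite: NesterenkoPhilippon2001, Ch. 3 Prop. 4.11 (pp. 40–41)] -/
def condBound (Q : Rx m) (d : ℕ) (ω : Fin (m + 1) → ℂ) (θ : ℝ) : ℝ :=
  maxNorm Q ^ ideg 𝔭 (s + 1) * 2 ^ (d * ideg 𝔭 (s + 1)) *
    (normAt ω Q + d * Q.support.card * θ) ^ ideg 𝔭 (s + 1) * archConst 𝔭 s ω ^ (d - 1) *
    (skewConst 𝔭 s ω * iabs 𝔭 (s + 1) ω)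

/-- The right-hand side of the unconditional estimate (some `δᵢ < θ`):
`|Q|^D A_max^d · 2^d (‖Q‖_ω̄ + d #supp Q θ) · (#supp Q)^{D−1}`.
[cite: NesterenkoPhilippon2001, Ch. 3 Prop. 4.11 (pp. 40–41)] -/
def smallBound (Q : Rx m) (d : ℕ) (ω : Fin (m + 1) → ℂ) (θ : ℝ) : ℝ :=
  maxNorm Q ^ ideg 𝔭 (s + 1) * archConst 𝔭 s ω ^ d *
    (2 ^ d * (normAt ω Q + d * Q.support.card * θ)) *
    (Q.support.card : ℝ) ^ (ideg 𝔭 (s + 1) - 1)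

/-- `A_max ≥ 0`. [folklore] -/
theorem archConst_nonneg (ω : Fin (m + 1) → ℂ) : 0 ≤ archConst 𝔭 s ω := by
  unfold archConst
  exact mul_nonneg (mul_nonneg (mul_nonneg (Real.exp_pos _).le (Nat.cast_nonneg _))
    (maxNorm_nonneg _)) (by positivity)

/-- `B₀ ≥ 0`. [folklore] -/
theorem skewConst_nonneg (ω : Fin (m + 1) → ℂ) : 0 ≤ skewConst 𝔭 s ω := by
  unfold skewConst
  exact mul_nonneg (mul_nonneg (mul_nonneg (mul_nonneg (Real.exp_pos _).le (by positivity))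
    (Nat.cast_nonneg _)) (maxNorm_nonneg _)) (by positivity)

end Bounds

/-! ### The estimate at a generic point -/

section Prime

variable {s : ℕ} {𝔭 : Ideal (Rx m)} {Q : Rx m} {d : ℕ} {q : ℚ}
  {Q₀ : MvPolynomial (Fin (m + 1)) ℤ}

set_option maxHeartbeats 1600000 in
/-- **The archimedean estimate for `G(zOf ω t)` at a generic `(t, ω̄)`** (see the module
docstring): for every `θ > 0`,
1. if `θ ≤ ρ(ω̄)` then `θ^D |ω̄|^D |q|^D |G(zOf ω t)| ≤ condBound(θ)`;
2. in any case `θ^D |ω̄|^D |q|^D |G(zOf ω t)| ≤ max (condBound θ) (θ^D |ω̄|^D smallBound θ)`.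
[cite: NesterenkoPhilippon2001, Ch. 3 Prop. 4.11 (pp. 40–41)] -/
theorem uResultant_value_dichotomy (hsm : s + 1 ≤ m) (h𝔭 : 𝔭.IsPrime)
    (hhom : 𝔭.IsHomogeneous (homogeneousSubmodule (Fin (m + 1)) ℚ))
    (hunm : IsUnmixedOfRank 𝔭 (s + 1)) (hQ : Q.IsHomogeneous d) (hd : 1 ≤ d) (hQ0 : Q ≠ 0)
    (hQQ₀ : Q = C q * MvPolynomial.map (Int.castRingHom ℚ) Q₀) (hQ₀ : Q₀.IsHomogeneous d)
    {ω : Fin (m + 1) → ℂ} {t : Fin s × SkewIdx m → ℂ} (hω : ω ≠ 0)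
    (hω1 : 1 ≤ ((m : ℝ) + 1) * ‖ω‖) (ht : ∀ v, ‖t v‖ ≤ 1)
    (hgen : Function.Injective
      (aeval (Sum.elim t ω) : MvPolynomial ((Fin s × SkewIdx m) ⊕ Fin (m + 1)) ℚ →ₐ[ℚ] ℂ))
    {θ : ℝ} (hθ : 0 < θ) :
    (θ ≤ rho ω 𝔭 →
      θ ^ ideg 𝔭 (s + 1) * ‖ω‖ ^ ideg 𝔭 (s + 1) *
          (‖(q : ℂ)‖ ^ ideg 𝔭 (s + 1) * ‖aeval (zOf ω t) (uResultant 𝔭 s d Q₀)‖) ≤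
        condBound 𝔭 s Q d ω θ) ∧
    θ ^ ideg 𝔭 (s + 1) * ‖ω‖ ^ ideg 𝔭 (s + 1) *
        (‖(q : ℂ)‖ ^ ideg 𝔭 (s + 1) * ‖aeval (zOf ω t) (uResultant 𝔭 s d Q₀)‖) ≤
      max (condBound 𝔭 s Q d ω θ)
        (θ ^ ideg 𝔭 (s + 1) * ‖ω‖ ^ ideg 𝔭 (s + 1) * smallBound 𝔭 s Q d ω θ) := by
  classical
  have hdim : ringKrullDim (Rx m ⧸ 𝔭) = (s + 1 : ℕ) :=
    ringKrullDim_quotient_eq_of_isUnmixedOfRank h𝔭 hunm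
  have hz : Function.Injective (aeval (zOf ω t) : RU s m →ₐ[ℚ] ℂ) :=
    injective_aeval_zOf (by omega) hgen
  obtain ⟨cz, bz, hcz, hbz, hbz𝔭, -, hF, hG⟩ := exists_split_complexSpec h𝔭 hhom hdim hQ₀ hz
  -- positivity
  have hω0 : 0 < ‖ω‖ := norm_pos_iff.mpr hω
  haveI := h𝔭
  have hF0 : chowForm 𝔭 (s + 1) ≠ 0 := (prime_chowForm 𝔭 hhom (Nat.succ_pos s) hdim).ne_zero
  have hMF : 0 < maxNorm (chowForm 𝔭 (s + 1)) := maxNorm_pos hF0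
  have hMQ : 0 < maxNorm Q := maxNorm_pos hQ0
  have hdegF : ∀ γ ∈ (chowForm 𝔭 (s + 1)).support, γ.degree = (s + 1) * ideg 𝔭 (s + 1) :=
    fun γ hγ => degree_eq_of_mem_support_chowForm 𝔭 (Nat.succ_pos s) hγ
  -- the data
  set A : ℝ := ‖cz‖ * ∏ i, ‖bz i‖ with hAdef
  have hA0 : 0 ≤ A := by positivity
  set δ : Fin (ideg 𝔭 (s + 1)) → ℝ := fun i => projDist ω (bz i) with hδdef
  have hδ0 : ∀ i, 0 ≤ δ i := fun i => projDist_nonneg _ _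
  have hρδ : ∀ i, rho ω 𝔭 ≤ δ i := fun i => rho_le_projDist ω ⟨hbz i, hbz𝔭 i⟩
  have hN0 : 0 ≤ normAt ω Q := normAt_nonneg ω Q
  set c₂ : ℝ := d * Q.support.card with hc₂def
  have hc₂0 : 0 ≤ c₂ := by positivity
  have hAC0 := archConst_nonneg 𝔭 s ω
  have hSC0 := skewConst_nonneg 𝔭 s ω
  have hι0 := iabs_nonneg 𝔭 (s + 1) ω
  -- (1) the value identity
  have hQβ : ∀ β : Fin (m + 1) → ℂ, aeval β Q = (q : ℂ) * aeval β Q₀ := fun β => by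
    rw [hQQ₀, map_mul, ← algebraMap_int_eq, aeval_map_algebraMap, aeval_C, eq_ratCast]
  have hval : ‖(q : ℂ)‖ ^ ideg 𝔭 (s + 1) * ‖aeval (zOf ω t) (uResultant 𝔭 s d Q₀)‖ =
      maxNorm Q ^ ideg 𝔭 (s + 1) * A ^ d * ∏ i, normAt (bz i) Q := by
    have hfac : ∀ i, ‖(q : ℂ)‖ * ‖aeval (bz i) Q₀‖ =
        normAt (bz i) Q * (maxNorm Q * ‖bz i‖ ^ d) := fun i => by
      rw [← norm_aeval_eq_normAt_mul hQ hQ0 (hbz i), hQβ, norm_mul]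
    rw [hG, norm_mul, norm_pow, norm_prod]
    calc ‖(q : ℂ)‖ ^ ideg 𝔭 (s + 1) * (‖cz‖ ^ d * ∏ i, ‖aeval (bz i) Q₀‖)
        = ‖cz‖ ^ d * ∏ i, (‖(q : ℂ)‖ * ‖aeval (bz i) Q₀‖) := by
          rw [Finset.prod_mul_distrib, Finset.prod_const, Finset.card_univ, Fintype.card_fin]
          ring
      _ = ‖cz‖ ^ d * ∏ i, (normAt (bz i) Q * (maxNorm Q * ‖bz i‖ ^ d)) := by
          simp_rw [hfac]
      _ = maxNorm Q ^ ideg 𝔭 (s + 1) * A ^ d * ∏ i, normAt (bz i) Q := by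
          rw [Finset.prod_mul_distrib, Finset.prod_mul_distrib, Finset.prod_const,
            Finset.card_univ, Fintype.card_fin, Finset.prod_pow, hAdef, mul_pow]
          ring
  -- (2) `A ≤ A_max`
  have hAle : A ≤ archConst 𝔭 s ω := by
    have h2 : A ≤ Real.exp ((m : ℝ) * ideg 𝔭 (s + 1)) *
        maxNorm (MvPolynomial.map ((aeval (zOf ω t) : RU s m →ₐ[ℚ] ℂ) : RU s m →+* ℂ)
          (splitLast s m (chowForm 𝔭 (s + 1)))) := by
      rw [hF, maxNorm_C_mul]
      calc A ≤ ‖cz‖ * (Real.exp ((m : ℝ) * ideg 𝔭 (s + 1)) *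
            maxNorm (∏ i, (∑ j, C (bz i j) * X j) : MvPolynomial (Fin (m + 1)) ℂ)) :=
            mul_le_mul_of_nonneg_left (prod_norm_le_exp_mul_maxNorm_prod_lin bz hbz)
              (norm_nonneg _)
        _ = _ := by ring
    have h3 := maxNorm_map_aeval_splitLast_le_pow (chowForm 𝔭 (s + 1)) hω1
      (fun w => norm_zOf_le ω ht w) (fun e he => (hdegF e he).le)
    calc A ≤ _ := h2
      _ ≤ Real.exp ((m : ℝ) * ideg 𝔭 (s + 1)) * ((chowForm 𝔭 (s + 1)).support.card *
            maxNorm (chowForm 𝔭 (s + 1)) * (((m : ℝ) + 1) * ‖ω‖) ^ ((s + 1) * ideg 𝔭 (s + 1))) :=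
          mul_le_mul_of_nonneg_left h3 (Real.exp_pos _).le
      _ = archConst 𝔭 s ω := by unfold archConst; ring
  -- (3) the skew estimate: `(∏ δ) |ω|^D A ≤ B₀ ι` when all `δ i > 0`
  set ℓ : Fin (ideg 𝔭 (s + 1)) → RS 1 m := fun i =>
    aeval (fun j => lam ω (0 : Fin 1) j) (∑ j, C (bz i j) * X j : MvPolynomial (Fin (m + 1)) ℂ)
    with hℓdef
  have hΦ : blockSpec t (kappa ω (chowForm 𝔭 (s + 1))) = C cz * ∏ i, ℓ i := by
    rw [blockSpec_kappa, hF, map_mul, algHom_C, MvPolynomial.algebraMap_eq, map_prod]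
  have hℓlow : ∀ i, δ i * (‖ω‖ * ‖bz i‖) ≤ maxNorm (ℓ i) := fun i =>
    projDist_mul_le_maxNorm_aeval_lam_linC ω (bz i)
  have hκ : maxNorm (kappa ω (chowForm 𝔭 (s + 1))) =
      iabs 𝔭 (s + 1) ω * (maxNorm (chowForm 𝔭 (s + 1)) * ‖ω‖ ^ ((s + 1) * ideg 𝔭 (s + 1))) := by
    unfold iabs
    rw [div_mul_cancel₀]
    exact mul_ne_zero hMF.ne' (pow_ne_zero _ hω0.ne')
  have hB : (∀ i, 0 < δ i) →
      (∏ i, δ i) * ‖ω‖ ^ ideg 𝔭 (s + 1) * A ≤ skewConst 𝔭 s ω * iabs 𝔭 (s + 1) ω := by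
    intro hδpos
    have hℓ0 : ∀ i, ℓ i ≠ 0 := fun i h0 => by
      have h := hℓlow i
      rw [h0, maxNorm_zero] at h
      have : 0 < δ i * (‖ω‖ * ‖bz i‖) :=
        mul_pos (hδpos i) (mul_pos hω0 (norm_pos_iff.mpr (hbz i)))
      linarith
    have hgel := prod_maxNorm_le_exp_mul_maxNorm_prod Finset.univ ℓ fun i _ => hℓ0 i
    have hdeg : (∑ v : Fin 1 × SkewIdx m, (∑ i, degreeOf v (ℓ i) : ℝ)) ≤
        (Fintype.card (SkewIdx m) : ℝ) * ideg 𝔭 (s + 1) := by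
      calc (∑ v : Fin 1 × SkewIdx m, (∑ i, degreeOf v (ℓ i) : ℝ))
          ≤ ∑ _v : Fin 1 × SkewIdx m, (ideg 𝔭 (s + 1) : ℝ) := by
            refine Finset.sum_le_sum fun v _ => ?_
            calc (∑ i, (degreeOf v (ℓ i) : ℝ)) ≤ ∑ _i : Fin (ideg 𝔭 (s + 1)), (1 : ℝ) :=
                  Finset.sum_le_sum fun i _ => by
                    exact_mod_cast degreeOf_aeval_lam_linC_le ω (bz i) v
              _ = ideg 𝔭 (s + 1) := by simp
        _ = (Fintype.card (SkewIdx m) : ℝ) * ideg 𝔭 (s + 1) := by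
            rw [Finset.sum_const, Finset.card_univ, nsmul_eq_mul, Fintype.card_prod,
              Fintype.card_fin, one_mul]
    have hcard : ((kappa ω (chowForm 𝔭 (s + 1))).support.card : ℝ) ≤
        (chowForm 𝔭 (s + 1)).support.card * ((m : ℝ) + 1) ^ ((s + 1) * ideg 𝔭 (s + 1)) := by
      exact_mod_cast card_support_kappa_le ω (chowForm 𝔭 (s + 1)) hdegF
    calc (∏ i, δ i) * ‖ω‖ ^ ideg 𝔭 (s + 1) * A = ‖cz‖ * ∏ i, (δ i * (‖ω‖ * ‖bz i‖)) := by
          rw [Finset.prod_mul_distrib, Finset.prod_mul_distrib, Finset.prod_const, Finset.card_univ,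
            Fintype.card_fin, hAdef]
          ring
      _ ≤ ‖cz‖ * ∏ i, maxNorm (ℓ i) :=
          mul_le_mul_of_nonneg_left (Finset.prod_le_prod (fun i _ => by
            have := hδ0 i; positivity) fun i _ => hℓlow i) (norm_nonneg _)
      _ ≤ ‖cz‖ * (Real.exp ((Fintype.card (SkewIdx m) : ℝ) * ideg 𝔭 (s + 1)) *
            maxNorm (∏ i, ℓ i)) := by
          refine mul_le_mul_of_nonneg_left (hgel.trans ?_) (norm_nonneg _)
          exact mul_le_mul_of_nonneg_right (Real.exp_le_exp.mpr hdeg) (maxNorm_nonneg _)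
      _ = Real.exp ((Fintype.card (SkewIdx m) : ℝ) * ideg 𝔭 (s + 1)) *
            maxNorm (blockSpec t (kappa ω (chowForm 𝔭 (s + 1)))) := by
          rw [hΦ, maxNorm_C_mul]; ring
      _ ≤ Real.exp ((Fintype.card (SkewIdx m) : ℝ) * ideg 𝔭 (s + 1)) *
            ((kappa ω (chowForm 𝔭 (s + 1))).support.card *
              maxNorm (kappa ω (chowForm 𝔭 (s + 1)))) :=
          mul_le_mul_of_nonneg_left (maxNorm_blockSpec_le ht _) (Real.exp_pos _).le
      _ ≤ Real.exp ((Fintype.card (SkewIdx m) : ℝ) * ideg 𝔭 (s + 1)) *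
            ((chowForm 𝔭 (s + 1)).support.card * ((m : ℝ) + 1) ^ ((s + 1) * ideg 𝔭 (s + 1)) *
              maxNorm (kappa ω (chowForm 𝔭 (s + 1)))) := by
          refine mul_le_mul_of_nonneg_left ?_ (Real.exp_pos _).le
          exact mul_le_mul_of_nonneg_right hcard (maxNorm_nonneg _)
      _ = skewConst 𝔭 s ω * iabs 𝔭 (s + 1) ω := by
          rw [hκ]; unfold skewConst; ring
  -- (4) values of `Q` at the `β̂`
  have hV : ∀ i, normAt (bz i) Q ≤ 2 ^ d * (normAt ω Q + c₂ * δ i) := fun i => by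
    rw [hc₂def]
    exact normAt_le_of_projDist hQ hQ0 hd hω (hbz i)
  have hnA : ∀ i, 0 ≤ normAt (bz i) Q := fun i => normAt_nonneg _ _
  -- (5) the conditional estimate
  have hcond : (∀ i, θ ≤ δ i) →
      θ ^ ideg 𝔭 (s + 1) * ‖ω‖ ^ ideg 𝔭 (s + 1) *
          (‖(q : ℂ)‖ ^ ideg 𝔭 (s + 1) * ‖aeval (zOf ω t) (uResultant 𝔭 s d Q₀)‖) ≤
        condBound 𝔭 s Q d ω θ := by
    intro hθδ
    have hPB := hB fun i => hθ.trans_le (hθδ i)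
    -- `θ^D ∏ normAt ≤ 2^{dD} (N + c₂ θ)^D ∏ δ`
    have hprod : θ ^ ideg 𝔭 (s + 1) * ∏ i, normAt (bz i) Q ≤
        2 ^ (d * ideg 𝔭 (s + 1)) * (normAt ω Q + c₂ * θ) ^ ideg 𝔭 (s + 1) * ∏ i, δ i := by
      have hfac : ∀ i, θ * normAt (bz i) Q ≤ 2 ^ d * (normAt ω Q + c₂ * θ) * δ i := fun i => by
        calc θ * normAt (bz i) Q ≤ θ * (2 ^ d * (normAt ω Q + c₂ * δ i)) :=
              mul_le_mul_of_nonneg_left (hV i) hθ.le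
          _ = 2 ^ d * (θ * normAt ω Q + c₂ * θ * δ i) := by ring
          _ ≤ 2 ^ d * (δ i * normAt ω Q + c₂ * θ * δ i) := by
              gcongr
              exact hθδ i
          _ = 2 ^ d * (normAt ω Q + c₂ * θ) * δ i := by ring
      calc θ ^ ideg 𝔭 (s + 1) * ∏ i, normAt (bz i) Q = ∏ i, (θ * normAt (bz i) Q) := by
            rw [Finset.prod_mul_distrib, Finset.prod_const, Finset.card_univ, Fintype.card_fin]
        _ ≤ ∏ i, (2 ^ d * (normAt ω Q + c₂ * θ) * δ i) :=
            Finset.prod_le_prod (fun i _ => mul_nonneg hθ.le (hnA i)) fun i _ => hfac i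
        _ = 2 ^ (d * ideg 𝔭 (s + 1)) * (normAt ω Q + c₂ * θ) ^ ideg 𝔭 (s + 1) * ∏ i, δ i := by
            rw [Finset.prod_mul_distrib, Finset.prod_const, Finset.card_univ, Fintype.card_fin,
              mul_pow, pow_mul]
    have hAd : A ^ d = A ^ (d - 1) * A := (pow_sub_one_mul (by omega : d ≠ 0) A).symm
    have hApow : A ^ (d - 1) ≤ archConst 𝔭 s ω ^ (d - 1) := pow_le_pow_left₀ hA0 hAle _
    have hK0 : 0 ≤ 2 ^ (d * ideg 𝔭 (s + 1)) * (normAt ω Q + c₂ * θ) ^ ideg 𝔭 (s + 1) := by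
      positivity
    calc θ ^ ideg 𝔭 (s + 1) * ‖ω‖ ^ ideg 𝔭 (s + 1) *
          (‖(q : ℂ)‖ ^ ideg 𝔭 (s + 1) * ‖aeval (zOf ω t) (uResultant 𝔭 s d Q₀)‖)
        = maxNorm Q ^ ideg 𝔭 (s + 1) * A ^ (d - 1) *
            ((θ ^ ideg 𝔭 (s + 1) * ∏ i, normAt (bz i) Q) * (‖ω‖ ^ ideg 𝔭 (s + 1) * A)) := by
          rw [hval, hAd]; ring
      _ ≤ maxNorm Q ^ ideg 𝔭 (s + 1) * A ^ (d - 1) *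
            ((2 ^ (d * ideg 𝔭 (s + 1)) * (normAt ω Q + c₂ * θ) ^ ideg 𝔭 (s + 1) * ∏ i, δ i) *
              (‖ω‖ ^ ideg 𝔭 (s + 1) * A)) := by
          refine mul_le_mul_of_nonneg_left (mul_le_mul_of_nonneg_right hprod (by positivity)) ?_
          positivity
      _ = maxNorm Q ^ ideg 𝔭 (s + 1) *
            (2 ^ (d * ideg 𝔭 (s + 1)) * (normAt ω Q + c₂ * θ) ^ ideg 𝔭 (s + 1)) *
            A ^ (d - 1) * ((∏ i, δ i) * ‖ω‖ ^ ideg 𝔭 (s + 1) * A) := by ring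
      _ ≤ maxNorm Q ^ ideg 𝔭 (s + 1) *
            (2 ^ (d * ideg 𝔭 (s + 1)) * (normAt ω Q + c₂ * θ) ^ ideg 𝔭 (s + 1)) *
            archConst 𝔭 s ω ^ (d - 1) * (skewConst 𝔭 s ω * iabs 𝔭 (s + 1) ω) := by
          refine mul_le_mul (mul_le_mul_of_nonneg_left hApow (by positivity)) hPB ?_ ?_
          · have : 0 ≤ ∏ i, δ i := Finset.prod_nonneg fun i _ => hδ0 i
            positivity
          · exact mul_nonneg (by positivity) (pow_nonneg hAC0 _)
      _ = condBound 𝔭 s Q d ω θ := by unfold condBound; rw [hc₂def]; ring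
  -- (6) the unconditional estimate when some `δ i < θ`
  have hsmall : ∀ i₀, δ i₀ < θ →
      ‖(q : ℂ)‖ ^ ideg 𝔭 (s + 1) * ‖aeval (zOf ω t) (uResultant 𝔭 s d Q₀)‖ ≤
        smallBound 𝔭 s Q d ω θ := by
    intro i₀ hi₀
    have hsplit : ∏ i, normAt (bz i) Q =
        normAt (bz i₀) Q * ∏ i ∈ Finset.univ.erase i₀, normAt (bz i) Q :=
      (Finset.mul_prod_erase _ _ (Finset.mem_univ i₀)).symm
    have h1 : normAt (bz i₀) Q ≤ 2 ^ d * (normAt ω Q + c₂ * θ) :=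
      (hV i₀).trans (by gcongr)
    have h2 : ∏ i ∈ Finset.univ.erase i₀, normAt (bz i) Q ≤
        (Q.support.card : ℝ) ^ (ideg 𝔭 (s + 1) - 1) := by
      calc ∏ i ∈ Finset.univ.erase i₀, normAt (bz i) Q
          ≤ ∏ _i ∈ Finset.univ.erase i₀, (Q.support.card : ℝ) :=
            Finset.prod_le_prod (fun i _ => hnA i) fun i _ => normAt_le_card_support hQ hQ0 _
        _ = (Q.support.card : ℝ) ^ (ideg 𝔭 (s + 1) - 1) := by
            rw [Finset.prod_const, Finset.card_erase_of_mem (Finset.mem_univ i₀),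
              Finset.card_univ, Fintype.card_fin]
    have hprod : ∏ i, normAt (bz i) Q ≤
        2 ^ d * (normAt ω Q + c₂ * θ) * (Q.support.card : ℝ) ^ (ideg 𝔭 (s + 1) - 1) := by
      rw [hsplit]
      exact mul_le_mul h1 h2 (Finset.prod_nonneg fun i _ => hnA i) (by positivity)
    have hApow : A ^ d ≤ archConst 𝔭 s ω ^ d := pow_le_pow_left₀ hA0 hAle _
    calc ‖(q : ℂ)‖ ^ ideg 𝔭 (s + 1) * ‖aeval (zOf ω t) (uResultant 𝔭 s d Q₀)‖
        = maxNorm Q ^ ideg 𝔭 (s + 1) * A ^ d * ∏ i, normAt (bz i) Q := hval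
      _ ≤ maxNorm Q ^ ideg 𝔭 (s + 1) * archConst 𝔭 s ω ^ d *
            (2 ^ d * (normAt ω Q + c₂ * θ) * (Q.support.card : ℝ) ^ (ideg 𝔭 (s + 1) - 1)) := by
          refine mul_le_mul (mul_le_mul_of_nonneg_left hApow (by positivity)) hprod
            (Finset.prod_nonneg fun i _ => hnA i) (by positivity)
      _ = smallBound 𝔭 s Q d ω θ := by unfold smallBound; rw [hc₂def]; ring
  -- conclusion
  refine ⟨fun hθρ => hcond fun i => hθρ.trans (hρδ i), ?_⟩
  by_cases hall : ∀ i, θ ≤ δ i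
  · exact (hcond hall).trans (le_max_left _ _)
  · push Not at hall
    obtain ⟨i₀, hi₀⟩ := hall
    exact (mul_le_mul_of_nonneg_left (hsmall i₀ hi₀) (by positivity)).trans (le_max_right _ _)

end Prime


/-! ### `ϰ` is polynomial in `ω̄` -/

/-- The entries of the generic skew-symmetric matrices with coefficients in `ℚ[x̲]` (the
coordinates of `ω̄` kept as variables). [cite: NesterenkoPhilippon2001, Ch. 3 Def. 4.6 (p. 39)] -/
def skewEntryU {r : ℕ} (i : Fin r) (j k : Fin (m + 1)) : MvPolynomial (Fin r × SkewIdx m) (Rx m) :=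
  if h : j < k then X (i, ⟨(j, k), h⟩) else if h' : k < j then -X (i, ⟨(k, j), h'⟩) else 0

/-- `ϰ(F)` with `ω̄` kept as variables: `ϰ_ω̄(F)` is its specialisation at `ω̄` (`map_kappaU`).
[cite: NesterenkoPhilippon2001, Ch. 3 Def. 4.6 (p. 39)] -/
def kappaU {r : ℕ} (F : RU r m) : MvPolynomial (Fin r × SkewIdx m) (Rx m) :=
  aeval (fun ij : Fin r × Fin (m + 1) => ∑ k : Fin (m + 1), skewEntryU ij.1 ij.2 k * C (X k)) F

/-- Specialising `ω̄` in `skewEntryU` gives `skewEntry`. [folklore] -/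
theorem map_skewEntryU {r : ℕ} (ω : Fin (m + 1) → ℂ) (i : Fin r) (j k : Fin (m + 1)) :
    MvPolynomial.map ((aeval ω : Rx m →ₐ[ℚ] ℂ) : Rx m →+* ℂ) (skewEntryU i j k) =
      skewEntry i j k := by
  unfold skewEntryU skewEntry
  split_ifs <;> simp

/-- **`ϰ_ω̄(F)` is the specialisation of `kappaU F` at `ω̄`.** [folklore] -/
theorem map_kappaU {r : ℕ} (ω : Fin (m + 1) → ℂ) (F : RU r m) :
    MvPolynomial.map ((aeval ω : Rx m →ₐ[ℚ] ℂ) : Rx m →+* ℂ) (kappaU F) = kappa ω F := by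
  have key : (MvPolynomial.map ((aeval ω : Rx m →ₐ[ℚ] ℂ) : Rx m →+* ℂ)).comp
      ((aeval (fun ij : Fin r × Fin (m + 1) =>
        ∑ k : Fin (m + 1), skewEntryU ij.1 ij.2 k * C (X k)) :
          RU r m →ₐ[ℚ] MvPolynomial (Fin r × SkewIdx m) (Rx m)) : RU r m →+* _) =
      ((aeval (fun ij : Fin r × Fin (m + 1) =>
        ∑ k : Fin (m + 1), skewEntry ij.1 ij.2 k * C (ω k)) : RU r m →ₐ[ℚ] RS r m) :
          RU r m →+* RS r m) := by
    refine ringHom_ext (fun q => ?_) (fun ij => ?_)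
    · simp only [RingHom.coe_comp, RingHom.coe_coe, Function.comp_apply, aeval_C,
        MvPolynomial.algebraMap_apply, map_C, Algebra.algebraMap_self, RingHom.id_apply]
    · simp only [RingHom.coe_comp, RingHom.coe_coe, Function.comp_apply, aeval_X, map_sum,
        map_mul, map_C, map_skewEntryU]
  exact RingHom.congr_fun key F

/-! ### Continuity in `ω̄` -/

/-- **`ω̄ ↦ |ϰ_ω̄(F)|` is continuous.** [folklore] -/
theorem continuous_maxNorm_kappa {r : ℕ} (F : RU r m) :
    Continuous fun ω : Fin (m + 1) → ℂ => maxNorm (kappa ω F) := by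
  have h := continuous_maxNorm_map_aeval (ι := Fin (m + 1)) (kappaU F)
  simp only [map_kappaU] at h
  exact h

/-- `ω̄ ↦ |I(ω̄)|` is continuous at every `ω̄ ≠ 0`. [folklore] -/
theorem continuousAt_iabs (I : Ideal (Rx m)) (r : ℕ) {ω₀ : Fin (m + 1) → ℂ} (hω₀ : ω₀ ≠ 0) :
    ContinuousAt (fun ω => iabs I r ω) ω₀ := by
  by_cases hF : maxNorm (chowForm I r) = 0
  · have : (fun ω : Fin (m + 1) → ℂ => iabs I r ω) = fun _ => 0 := by
      funext ω; unfold iabs; rw [hF, zero_mul, div_zero]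
    rw [this]; exact continuousAt_const
  · unfold iabs
    exact ((continuous_maxNorm_kappa _).continuousAt).div
      ((continuous_const.mul (continuous_norm.pow _)).continuousAt)
      (mul_ne_zero hF (pow_ne_zero _ (norm_ne_zero_iff.mpr hω₀)))

/-- `ω̄ ↦ ‖Q‖_ω̄` is continuous at every `ω̄ ≠ 0`. [folklore] -/
theorem continuousAt_normAt (Q : Rx m) {ω₀ : Fin (m + 1) → ℂ} (hω₀ : ω₀ ≠ 0) :
    ContinuousAt (fun ω => normAt ω Q) ω₀ := by
  by_cases hQ : maxNorm Q = 0
  · have : (fun ω : Fin (m + 1) → ℂ => normAt ω Q) = fun _ => 0 := by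
      funext ω; unfold normAt; rw [hQ, zero_mul, div_zero]
    rw [this]; exact continuousAt_const
  · unfold normAt
    exact ((continuous_aeval Q).norm.continuousAt).div
      ((continuous_const.mul (continuous_norm.pow _)).continuousAt)
      (mul_ne_zero hQ (pow_ne_zero _ (norm_ne_zero_iff.mpr hω₀)))

section Consts

variable (𝔭 : Ideal (Rx m)) (s : ℕ)

/-- `A_max` is continuous in `ω̄`. [folklore] -/
theorem continuous_archConst : Continuous fun ω : Fin (m + 1) → ℂ => archConst 𝔭 s ω := by
  unfold archConst
  exact continuous_const.mul ((continuous_const.mul continuous_norm).pow _)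

/-- `B₀` is continuous in `ω̄`. [folklore] -/
theorem continuous_skewConst : Continuous fun ω : Fin (m + 1) → ℂ => skewConst 𝔭 s ω := by
  unfold skewConst
  exact continuous_const.mul (continuous_norm.pow _)

/-- `condBound` is continuous at `ω̄ ≠ 0`. [folklore] -/
theorem continuousAt_condBound (Q : Rx m) (d : ℕ) {ω₀ : Fin (m + 1) → ℂ} (hω₀ : ω₀ ≠ 0) (θ : ℝ) :
    ContinuousAt (fun ω => condBound 𝔭 s Q d ω θ) ω₀ := by
  unfold condBound
  have hN := continuousAt_normAt Q hω₀
  have hι := continuousAt_iabs 𝔭 (s + 1) hω₀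
  have hA : ContinuousAt (fun ω => archConst 𝔭 s ω) ω₀ := (continuous_archConst 𝔭 s).continuousAt
  have hS : ContinuousAt (fun ω => skewConst 𝔭 s ω) ω₀ := (continuous_skewConst 𝔭 s).continuousAt
  exact ((continuousAt_const.mul ((hN.add continuousAt_const).pow _)).mul (hA.pow _)).mul
    (hS.mul hι)

/-- `smallBound` is continuous at `ω̄ ≠ 0`. [folklore] -/
theorem continuousAt_smallBound (Q : Rx m) (d : ℕ) {ω₀ : Fin (m + 1) → ℂ} (hω₀ : ω₀ ≠ 0) (θ : ℝ) :
    ContinuousAt (fun ω => smallBound 𝔭 s Q d ω θ) ω₀ := by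
  unfold smallBound
  have hN := continuousAt_normAt Q hω₀
  have hA : ContinuousAt (fun ω => archConst 𝔭 s ω) ω₀ := (continuous_archConst 𝔭 s).continuousAt
  exact ((continuousAt_const.mul (hA.pow _)).mul
    (continuousAt_const.mul (hN.add continuousAt_const))).mul continuousAt_const

/-- `valueConst(ω̄) = max (|Q|^D 2^{dD} (1 + d #supp Q)^D A_max^{d−1} B₀ e^{5 m² D})
(|Q|^D A_max^d 2^d (1 + d #supp Q) (#supp Q)^{D−1})`, the constant in the value estimate (it only
depends on `|ω̄|`). [cite: NesterenkoPhilippon2001, Ch. 3 Prop. 4.11 3) (p. 41)] -/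
def valueConst (Q : Rx m) (d : ℕ) (ω : Fin (m + 1) → ℂ) : ℝ :=
  max (maxNorm Q ^ ideg 𝔭 (s + 1) * 2 ^ (d * ideg 𝔭 (s + 1)) *
        (1 + d * Q.support.card) ^ ideg 𝔭 (s + 1) * archConst 𝔭 s ω ^ (d - 1) *
        skewConst 𝔭 s ω * Real.exp (5 * (m : ℝ) ^ 2 * ideg 𝔭 (s + 1)))
    (maxNorm Q ^ ideg 𝔭 (s + 1) * archConst 𝔭 s ω ^ d * (2 ^ d * (1 + d * Q.support.card)) *
        (Q.support.card : ℝ) ^ (ideg 𝔭 (s + 1) - 1))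

end Consts

/-! ### From generic points to the closure of an open set -/

/-- **Closed conditions pass from the generic points of an open set to its closure**: if
`f z ≤ g z` at every `z ∈ U` with algebraically independent coordinates, and `f, g` are
continuous at `z₀ ∈ closure U`, then `f z₀ ≤ g z₀`. [folklore] -/
theorem le_of_forall_generic_of_isOpen {ι : Type*} [Fintype ι] {U : Set (ι → ℂ)} (hU : IsOpen U)
    {f g : (ι → ℂ) → ℝ}
    (h : ∀ z ∈ U, Function.Injective (aeval z : MvPolynomial ι ℚ →ₐ[ℚ] ℂ) → f z ≤ g z)
    {z : ι → ℂ} (hz : z ∈ closure U) (hf : ContinuousAt f z) (hg : ContinuousAt g z) :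
    f z ≤ g z := by
  set S : Set (ι → ℂ) := U ∩ {z | Function.Injective (aeval z : MvPolynomial ι ℚ →ₐ[ℚ] ℂ)}
    with hS
  have hUS : U ⊆ closure S := (dense_setOf_injective_aeval ι).open_subset_closure_inter hU
  have hzS : z ∈ closure S := closure_minimal hUS isClosed_closure hz
  exact ContinuousWithinAt.closure_le hzS hf.continuousWithinAt hg.continuousWithinAt
    fun y hy => h y hy.1 hy.2

/-! ### `ρ` is lower semicontinuous -/

/-- **`ρ(ω̄₀) |ω̄₀| ≤ ρ(ω̄) |ω̄| + 2 |ω̄ − ω̄₀|`** for `ω̄ ≠ 0` (each minor of `(ω̄₀, β̄)` differs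
from the corresponding minor of `(ω̄, β̄)` by at most `2 |ω̄ − ω̄₀| |β̄|`). [folklore] -/
theorem rho_mul_norm_le (I : Ideal (Rx m)) (ω₀ ω : Fin (m + 1) → ℂ) (hω : ω ≠ 0) :
    rho ω₀ I * ‖ω₀‖ ≤ rho ω I * ‖ω‖ + 2 * ‖ω - ω₀‖ := by
  by_cases hne : (projZeros I).Nonempty
  swap
  · rw [Set.not_nonempty_iff_eq_empty] at hne
    simp only [rho, hne, Set.image_empty, Real.sInf_empty, zero_mul, zero_add]
    positivity
  have hω0 : 0 < ‖ω‖ := norm_pos_iff.mpr hω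
  have key : ∀ β ∈ projZeros I,
      rho ω₀ I * ‖ω₀‖ ≤ projDist ω β * ‖ω‖ + 2 * ‖ω - ω₀‖ := by
    intro β hβ
    have hβ0 : 0 < ‖β‖ := norm_pos_iff.mpr hβ.1
    refine (mul_le_mul_of_nonneg_right (rho_le_projDist ω₀ hβ) (norm_nonneg _)).trans ?_
    by_cases hω₀ : ω₀ = 0
    · subst hω₀
      rw [norm_zero, mul_zero]
      have := projDist_nonneg ω β
      positivity
    refine le_of_mul_le_mul_right ?_ hβ0
    rw [mul_assoc, projDist_mul_norm_mul_norm hω₀ hβ.1]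
    refine sup_minor_le ω₀ β (by have := projDist_nonneg ω β; positivity) fun p => ?_
    have hsub : ∀ a b : Fin (m + 1), ‖(ω - ω₀) a * β b‖ ≤ ‖ω - ω₀‖ * ‖β‖ := fun a b => by
      rw [norm_mul]
      exact mul_le_mul (norm_le_pi_norm _ _) (norm_le_pi_norm _ _) (norm_nonneg _) (norm_nonneg _)
    calc ‖ω₀ p.1.1 * β p.1.2 - ω₀ p.1.2 * β p.1.1‖
        = ‖(ω p.1.1 * β p.1.2 - ω p.1.2 * β p.1.1) -
            ((ω - ω₀) p.1.1 * β p.1.2 - (ω - ω₀) p.1.2 * β p.1.1)‖ := by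
          congr 1; simp only [Pi.sub_apply]; ring
      _ ≤ ‖ω p.1.1 * β p.1.2 - ω p.1.2 * β p.1.1‖ +
            ‖(ω - ω₀) p.1.1 * β p.1.2 - (ω - ω₀) p.1.2 * β p.1.1‖ := norm_sub_le _ _
      _ ≤ projDist ω β * (‖ω‖ * ‖β‖) + (‖ω - ω₀‖ * ‖β‖ + ‖ω - ω₀‖ * ‖β‖) :=
          add_le_add (norm_minor_le_projDist_mul ω β p.1.1 p.1.2)
            ((norm_sub_le _ _).trans (add_le_add (hsub _ _) (hsub _ _)))
      _ = (projDist ω β * ‖ω‖ + 2 * ‖ω - ω₀‖) * ‖β‖ := by ring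
  have h2 : (rho ω₀ I * ‖ω₀‖ - 2 * ‖ω - ω₀‖) / ‖ω‖ ≤ rho ω I :=
    le_rho_of_forall_le hne fun β hβ => by
      rw [div_le_iff₀ hω0]; linarith [key β hβ]
  rw [div_le_iff₀ hω0] at h2
  linarith

/-! ### Transfer to every `(t, ω̄)` -/

section Transfer

variable {s : ℕ} {𝔭 : Ideal (Rx m)} {Q : Rx m} {d : ℕ} {q : ℚ}
  {Q₀ : MvPolynomial (Fin (m + 1)) ℤ}

/-- The `ω̄`-part of a joint point `(t, ω̄)`. [folklore] -/
abbrev ωPart (s m : ℕ) (p : (Fin s × SkewIdx m) ⊕ Fin (m + 1) → ℂ) : Fin (m + 1) → ℂ :=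
  fun k => p (Sum.inr k)

/-- The `t`-part of a joint point `(t, ω̄)`. [folklore] -/
abbrev tPart (s m : ℕ) (p : (Fin s × SkewIdx m) ⊕ Fin (m + 1) → ℂ) : Fin s × SkewIdx m → ℂ :=
  fun v => p (Sum.inl v)

/-- A joint point is recovered from its two parts. [folklore] -/
theorem sumElim_tPart_ωPart (p : (Fin s × SkewIdx m) ⊕ Fin (m + 1) → ℂ) :
    Sum.elim (tPart s m p) (ωPart s m p) = p := by
  funext x; cases x <;> rfl

/-- The `ω̄`-part is continuous. [folklore] -/
theorem continuous_ωPart : Continuous (ωPart s m) :=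
  continuous_pi fun k => continuous_apply (Sum.inr k)

/-- The path `c ↦ (c t₀, ω̄₀)` tends to `(t₀, ω̄₀)` as `c → 1⁻`, through points with `|c t₀| < 1`
when `|t₀| ≤ 1`. [folklore] -/
theorem mem_closure_of_scaling (t₀ : Fin s × SkewIdx m → ℂ) (ω₀ : Fin (m + 1) → ℂ)
    {U : Set ((Fin s × SkewIdx m) ⊕ Fin (m + 1) → ℂ)}
    (hU : ∀ c : ℝ, 0 < c → c < 1 → (Sum.elim (((c : ℂ)) • t₀) ω₀ : _ → ℂ) ∈ U) :
    (Sum.elim t₀ ω₀ : _ → ℂ) ∈ closure U := by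
  have hγ : Continuous fun c : ℝ =>
      (Sum.elim ((c : ℂ) • t₀) ω₀ : (Fin s × SkewIdx m) ⊕ Fin (m + 1) → ℂ) := by
    refine continuous_pi fun x => ?_
    cases x with
    | inl v =>
      simp only [Sum.elim_inl, Pi.smul_apply, smul_eq_mul]
      exact Complex.continuous_ofReal.mul continuous_const
    | inr k =>
      simp only [Sum.elim_inr]
      exact continuous_const
  have hlim : Tendsto (fun c : ℝ => (Sum.elim ((c : ℂ) • t₀) ω₀ : _ → ℂ)) (𝓝[<] 1)
      (𝓝 (Sum.elim t₀ ω₀)) := by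
    have := hγ.tendsto 1
    simp only [Complex.ofReal_one, one_smul] at this
    exact this.mono_left nhdsWithin_le_nhds
  refine mem_closure_of_tendsto hlim ?_
  filter_upwards [Ioo_mem_nhdsLT (zero_lt_one' ℝ)] with c hc
  exact hU c hc.1 hc.2

/-- `|c t₀| < 1` for `0 < c < 1`, `|t₀| ≤ 1`. [folklore] -/
theorem norm_smul_lt_one {t₀ : Fin s × SkewIdx m → ℂ} (ht₀ : ∀ v, ‖t₀ v‖ ≤ 1) {c : ℝ}
    (hc0 : 0 < c) (hc1 : c < 1) (v : Fin s × SkewIdx m) : ‖((c : ℂ) • t₀) v‖ < 1 := by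
  rw [Pi.smul_apply, smul_eq_mul, norm_mul, Complex.norm_real, Real.norm_of_nonneg hc0.le]
  calc c * ‖t₀ v‖ ≤ c * 1 := mul_le_mul_of_nonneg_left (ht₀ v) hc0.le
    _ < 1 := by linarith

set_option maxHeartbeats 3200000 in
/-- **The dichotomy at every `(t₀, ω̄₀)`** with `|t₀| ≤ 1`, `(m+1)|ω̄₀| > 1`: for `θ > 0`,
`θ^D |ω̄₀|^D |q|^D |G(zOf ω₀ t₀)| ≤ max (condBound θ) (θ^D |ω̄₀|^D smallBound θ)`.
[cite: NesterenkoPhilippon2001, Ch. 3 Prop. 4.11 3) (p. 41)] -/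
theorem dichotomy_at (hsm : s + 1 ≤ m) (h𝔭 : 𝔭.IsPrime)
    (hhom : 𝔭.IsHomogeneous (homogeneousSubmodule (Fin (m + 1)) ℚ))
    (hunm : IsUnmixedOfRank 𝔭 (s + 1)) (hQ : Q.IsHomogeneous d) (hd : 1 ≤ d) (hQ0 : Q ≠ 0)
    (hQQ₀ : Q = C q * MvPolynomial.map (Int.castRingHom ℚ) Q₀) (hQ₀ : Q₀.IsHomogeneous d)
    {ω₀ : Fin (m + 1) → ℂ} {t₀ : Fin s × SkewIdx m → ℂ} (hω₀ : 1 < ((m : ℝ) + 1) * ‖ω₀‖)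
    (ht₀ : ∀ v, ‖t₀ v‖ ≤ 1) {θ : ℝ} (hθ : 0 < θ) :
    θ ^ ideg 𝔭 (s + 1) * ‖ω₀‖ ^ ideg 𝔭 (s + 1) *
        (‖(q : ℂ)‖ ^ ideg 𝔭 (s + 1) * ‖aeval (zOf ω₀ t₀) (uResultant 𝔭 s d Q₀)‖) ≤
      max (condBound 𝔭 s Q d ω₀ θ)
        (θ ^ ideg 𝔭 (s + 1) * ‖ω₀‖ ^ ideg 𝔭 (s + 1) * smallBound 𝔭 s Q d ω₀ θ) := by
  classical
  have hω₀0 : ω₀ ≠ 0 := by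
    intro h; rw [h, norm_zero, mul_zero] at hω₀; linarith
  set Glam := aeval (fun w : Fin s × Fin (m + 1) => lamQ w.1 w.2) (uResultant 𝔭 s d Q₀) with hGlam
  rw [aeval_zOf_eq, ← hGlam]
  have hUo : IsOpen {p : (Fin s × SkewIdx m) ⊕ Fin (m + 1) → ℂ |
      (∀ v, ‖p (Sum.inl v)‖ < 1) ∧ 1 < ((m : ℝ) + 1) * ‖ωPart s m p‖} := by
    refine IsOpen.and ?_ (isOpen_lt continuous_const (continuous_const.mul continuous_ωPart.norm))
    simp only [Set.setOf_forall]
    exact isOpen_iInter_of_finite fun v => isOpen_lt (continuous_apply _).norm continuous_const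
  refine le_of_forall_generic_of_isOpen
    (f := fun p => θ ^ ideg 𝔭 (s + 1) * ‖ωPart s m p‖ ^ ideg 𝔭 (s + 1) *
      (‖(q : ℂ)‖ ^ ideg 𝔭 (s + 1) * ‖aeval p Glam‖))
    (g := fun p => max (condBound 𝔭 s Q d (ωPart s m p) θ)
      (θ ^ ideg 𝔭 (s + 1) * ‖ωPart s m p‖ ^ ideg 𝔭 (s + 1) *
        smallBound 𝔭 s Q d (ωPart s m p) θ))
    hUo ?_ (mem_closure_of_scaling t₀ ω₀ fun c hc0 hc1 =>
      ⟨norm_smul_lt_one ht₀ hc0 hc1, hω₀⟩) ?_ ?_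
  · rintro p ⟨ht, hω1⟩ hinj
    have hω : ωPart s m p ≠ 0 := by
      intro h; rw [h, norm_zero, mul_zero] at hω1; linarith
    have hgen : Function.Injective (aeval (Sum.elim (tPart s m p) (ωPart s m p)) :
        MvPolynomial ((Fin s × SkewIdx m) ⊕ Fin (m + 1)) ℚ →ₐ[ℚ] ℂ) := by
      rw [sumElim_tPart_ωPart]; exact hinj
    have h := (uResultant_value_dichotomy hsm h𝔭 hhom hunm hQ hd hQ0 hQQ₀ hQ₀ hω hω1.le
      (fun v => (ht v).le) hgen hθ).2
    rw [aeval_zOf_eq, sumElim_tPart_ωPart] at h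
    exact h
  · exact ((continuous_const.mul (continuous_ωPart.norm.pow _)).mul
      (continuous_const.mul (continuous_aeval Glam).norm)).continuousAt
  · have h1 : ContinuousAt (fun ω => condBound 𝔭 s Q d ω θ) (ωPart s m (Sum.elim t₀ ω₀)) :=
      continuousAt_condBound 𝔭 s Q d hω₀0 θ
    have h2 : ContinuousAt (fun ω => θ ^ ideg 𝔭 (s + 1) * ‖ω‖ ^ ideg 𝔭 (s + 1) *
        smallBound 𝔭 s Q d ω θ) (ωPart s m (Sum.elim t₀ ω₀)) :=
      (continuous_const.mul (continuous_norm.pow _)).continuousAt.mul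
        (continuousAt_smallBound 𝔭 s Q d hω₀0 θ)
    exact (h1.comp continuous_ωPart.continuousAt).max (h2.comp continuous_ωPart.continuousAt)

set_option maxHeartbeats 3200000 in
/-- **The conditional estimate at every `(t₀, ω̄₀)`** with `|t₀| ≤ 1`, `(m+1)|ω̄₀| > 1`: for
`0 < θ < ρ(ω̄₀)`, `θ^D |ω̄₀|^D |q|^D |G(zOf ω₀ t₀)| ≤ condBound θ`.
[cite: NesterenkoPhilippon2001, Ch. 3 Prop. 4.11 3) (p. 41)] -/
theorem cond_at (hsm : s + 1 ≤ m) (h𝔭 : 𝔭.IsPrime)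
    (hhom : 𝔭.IsHomogeneous (homogeneousSubmodule (Fin (m + 1)) ℚ))
    (hunm : IsUnmixedOfRank 𝔭 (s + 1)) (hQ : Q.IsHomogeneous d) (hd : 1 ≤ d) (hQ0 : Q ≠ 0)
    (hQQ₀ : Q = C q * MvPolynomial.map (Int.castRingHom ℚ) Q₀) (hQ₀ : Q₀.IsHomogeneous d)
    {ω₀ : Fin (m + 1) → ℂ} {t₀ : Fin s × SkewIdx m → ℂ} (hω₀ : 1 < ((m : ℝ) + 1) * ‖ω₀‖)
    (ht₀ : ∀ v, ‖t₀ v‖ ≤ 1) {θ : ℝ} (hθ : 0 < θ) (hθρ : θ < rho ω₀ 𝔭) :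
    θ ^ ideg 𝔭 (s + 1) * ‖ω₀‖ ^ ideg 𝔭 (s + 1) *
        (‖(q : ℂ)‖ ^ ideg 𝔭 (s + 1) * ‖aeval (zOf ω₀ t₀) (uResultant 𝔭 s d Q₀)‖) ≤
      condBound 𝔭 s Q d ω₀ θ := by
  classical
  have hω₀0 : ω₀ ≠ 0 := by
    intro h; rw [h, norm_zero, mul_zero] at hω₀; linarith
  have hω₀pos : 0 < ‖ω₀‖ := norm_pos_iff.mpr hω₀0
  set Glam := aeval (fun w : Fin s × Fin (m + 1) => lamQ w.1 w.2) (uResultant 𝔭 s d Q₀) with hGlam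
  rw [aeval_zOf_eq, ← hGlam]
  have hUo : IsOpen {p : (Fin s × SkewIdx m) ⊕ Fin (m + 1) → ℂ |
      (∀ v, ‖p (Sum.inl v)‖ < 1) ∧ 1 < ((m : ℝ) + 1) * ‖ωPart s m p‖ ∧
        θ * ‖ωPart s m p‖ < rho ω₀ 𝔭 * ‖ω₀‖ - 2 * ‖ωPart s m p - ω₀‖} := by
    refine IsOpen.and ?_ (IsOpen.and
      (isOpen_lt continuous_const (continuous_const.mul continuous_ωPart.norm))
      (isOpen_lt (continuous_const.mul continuous_ωPart.norm) (continuous_const.sub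
        (continuous_const.mul (continuous_ωPart.sub continuous_const).norm))))
    simp only [Set.setOf_forall]
    exact isOpen_iInter_of_finite fun v => isOpen_lt (continuous_apply _).norm continuous_const
  refine le_of_forall_generic_of_isOpen
    (f := fun p => θ ^ ideg 𝔭 (s + 1) * ‖ωPart s m p‖ ^ ideg 𝔭 (s + 1) *
      (‖(q : ℂ)‖ ^ ideg 𝔭 (s + 1) * ‖aeval p Glam‖))
    (g := fun p => condBound 𝔭 s Q d (ωPart s m p) θ)
    hUo ?_ (mem_closure_of_scaling t₀ ω₀ fun c hc0 hc1 =>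
      ⟨norm_smul_lt_one ht₀ hc0 hc1, hω₀, ?_⟩) ?_ ?_
  · rintro p ⟨ht, hω1, h3⟩ hinj
    have hω : ωPart s m p ≠ 0 := by
      intro h; rw [h, norm_zero, mul_zero] at hω1; linarith
    have hωpos : 0 < ‖ωPart s m p‖ := norm_pos_iff.mpr hω
    have hgen : Function.Injective (aeval (Sum.elim (tPart s m p) (ωPart s m p)) :
        MvPolynomial ((Fin s × SkewIdx m) ⊕ Fin (m + 1)) ℚ →ₐ[ℚ] ℂ) := by
      rw [sumElim_tPart_ωPart]; exact hinj
    have hρ := rho_mul_norm_le 𝔭 ω₀ (ωPart s m p) hω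
    have hlt : θ * ‖ωPart s m p‖ < rho (ωPart s m p) 𝔭 * ‖ωPart s m p‖ := by linarith
    have hθρ' : θ ≤ rho (ωPart s m p) 𝔭 := (lt_of_mul_lt_mul_right hlt hωpos.le).le
    have h := (uResultant_value_dichotomy hsm h𝔭 hhom hunm hQ hd hQ0 hQQ₀ hQ₀ hω hω1.le
      (fun v => (ht v).le) hgen hθ).1 hθρ'
    rw [aeval_zOf_eq, sumElim_tPart_ωPart] at h
    exact h
  · change θ * ‖ω₀‖ < rho ω₀ 𝔭 * ‖ω₀‖ - 2 * ‖(fun k => ω₀ k) - ω₀‖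
    rw [show (fun k => ω₀ k) = ω₀ from rfl, sub_self, norm_zero, mul_zero, sub_zero]
    exact mul_lt_mul_of_pos_right hθρ hω₀pos
  · exact ((continuous_const.mul (continuous_ωPart.norm.pow _)).mul
      (continuous_const.mul (continuous_aeval Glam).norm)).continuousAt
  · have h1 : ContinuousAt (fun ω => condBound 𝔭 s Q d ω θ) (ωPart s m (Sum.elim t₀ ω₀)) :=
      continuousAt_condBound 𝔭 s Q d hω₀0 θ
    exact h1.comp continuous_ωPart.continuousAt

end Transfer

/-! ### The value estimate at `|ω̄| = 1` -/

section Value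

variable {s : ℕ} {𝔭 : Ideal (Rx m)} {Q : Rx m} {d : ℕ} {q : ℚ}
  {Q₀ : MvPolynomial (Fin (m + 1)) ℤ}

set_option maxHeartbeats 800000 in
/-- **`|q|^D |ϰ_ω̄(G)| ≤ δ · valueConst` for `|ω̄| = 1`** (`G = uResultant 𝔭 s d Q₀`, `Q = q Q₀`,
`δ = bezoutDelta 𝔭 (s+1) Q ω̄`): the archimedean part of LNM 1752 Ch. 3 Prop. 4.11 3) before the
normalisations by `|G|`, `|F|`. Cases: `ρ < ‖Q‖_ω̄` (then `δ = ‖Q‖_ω̄`, `θ = ‖Q‖_ω̄` in the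
dichotomy and Cor. 4.10), `ρ ≥ ‖Q‖_ω̄`, `ρ > 0` (then `δ = |𝔭(ω̄)|`, `θ ↑ ρ` in the conditional
estimate), `ρ = ‖Q‖_ω̄ = 0` (then `|𝔭(ω̄)| = 0` and `θ ↓ 0` forces `ϰ_ω̄(G) = 0`).
[cite: NesterenkoPhilippon2001, Ch. 3 Prop. 4.11 3) (p. 41)] -/
theorem norm_mul_maxNorm_kappa_uResultant_le (hsm : s + 1 ≤ m) (h𝔭 : 𝔭.IsPrime)
    (hhom : 𝔭.IsHomogeneous (homogeneousSubmodule (Fin (m + 1)) ℚ))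
    (hunm : IsUnmixedOfRank 𝔭 (s + 1)) (hQ : Q.IsHomogeneous d) (hd : 1 ≤ d) (hQ0 : Q ≠ 0)
    (hQQ₀ : Q = C q * MvPolynomial.map (Int.castRingHom ℚ) Q₀) (hQ₀ : Q₀.IsHomogeneous d)
    {ω₀ : Fin (m + 1) → ℂ} (hω₀ : ‖ω₀‖ = 1) :
    ‖(q : ℂ)‖ ^ ideg 𝔭 (s + 1) * maxNorm (kappa ω₀ (uResultant 𝔭 s d Q₀)) ≤
      bezoutDelta 𝔭 (s + 1) Q ω₀ * valueConst 𝔭 s Q d ω₀ := by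
  classical
  have hω₀0 : ω₀ ≠ 0 := by
    intro h; rw [h, norm_zero] at hω₀; exact zero_ne_one hω₀
  have hm1 : 1 < ((m : ℝ) + 1) * ‖ω₀‖ := by
    rw [hω₀, mul_one]
    have : (1 : ℝ) ≤ m := by exact_mod_cast (by omega : 1 ≤ m)
    linarith
  have hq : q ≠ 0 := by
    rintro rfl
    rw [C_0, zero_mul] at hQQ₀
    exact hQ0 hQQ₀
  have hqpos : 0 < ‖(q : ℂ)‖ ^ ideg 𝔭 (s + 1) :=
    pow_pos (norm_pos_iff.mpr (by exact_mod_cast hq)) _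
  -- a point of the torus where `|ϰ(G)(t)| ≥ |ϰ(G)|`
  obtain ⟨ts, hts, hM⟩ := exists_eval_ge_maxNorm (kappa ω₀ (uResultant 𝔭 s d Q₀))
  rw [eval_kappa_eq_aeval] at hM
  have hts1 : ∀ v, ‖ts v‖ ≤ 1 := fun v => (hts v).le
  have hMnn : 0 ≤ maxNorm (kappa ω₀ (uResultant 𝔭 s d Q₀)) := maxNorm_nonneg _
  -- nonnegativity
  have hN0 : 0 ≤ normAt ω₀ Q := normAt_nonneg _ _
  have hρ0 : 0 ≤ rho ω₀ 𝔭 := rho_nonneg _ _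
  have hι0 : 0 ≤ iabs 𝔭 (s + 1) ω₀ := iabs_nonneg _ _ _
  have hAC := archConst_nonneg 𝔭 s ω₀
  have hSC := skewConst_nonneg 𝔭 s ω₀
  have hMQ : 0 < maxNorm Q := maxNorm_pos hQ0
  have hc0 : (0 : ℝ) ≤ Q.support.card := Nat.cast_nonneg _
  -- Corollary 4.10
  have h410 : iabs 𝔭 (s + 1) ω₀ ≤ rho ω₀ 𝔭 * Real.exp (5 * (m : ℝ) ^ 2 * ideg 𝔭 (s + 1)) :=
    NesterenkoPhilippon2001_ch3_cor_4_10_holds m (s + 1) 𝔭 (by omega) hsm h𝔭 hhom hunm ω₀ hω₀0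
  -- the transferred inequalities at `(ts, ω₀)`
  have R2 : ∀ θ, 0 < θ →
      θ ^ ideg 𝔭 (s + 1) * (‖(q : ℂ)‖ ^ ideg 𝔭 (s + 1) * maxNorm (kappa ω₀ (uResultant 𝔭 s d Q₀))) ≤
        max (condBound 𝔭 s Q d ω₀ θ) (θ ^ ideg 𝔭 (s + 1) * smallBound 𝔭 s Q d ω₀ θ) := by
    intro θ hθ
    have h := dichotomy_at hsm h𝔭 hhom hunm hQ hd hQ0 hQQ₀ hQ₀ hm1 hts1 hθ
    rw [hω₀, one_pow, mul_one] at h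
    refine le_trans ?_ h
    exact mul_le_mul_of_nonneg_left (mul_le_mul_of_nonneg_left hM hqpos.le) (pow_nonneg hθ.le _)
  have R1 : ∀ θ, 0 < θ → θ < rho ω₀ 𝔭 →
      θ ^ ideg 𝔭 (s + 1) * (‖(q : ℂ)‖ ^ ideg 𝔭 (s + 1) * maxNorm (kappa ω₀ (uResultant 𝔭 s d Q₀))) ≤
        condBound 𝔭 s Q d ω₀ θ := by
    intro θ hθ hθρ
    have h := cond_at hsm h𝔭 hhom hunm hQ hd hQ0 hQQ₀ hQ₀ hm1 hts1 hθ hθρ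
    rw [hω₀, one_pow, mul_one] at h
    refine le_trans ?_ h
    exact mul_le_mul_of_nonneg_left (mul_le_mul_of_nonneg_left hM hqpos.le) (pow_nonneg hθ.le _)
  -- the two constants
  have hKI0 : 0 ≤ maxNorm Q ^ ideg 𝔭 (s + 1) * 2 ^ (d * ideg 𝔭 (s + 1)) *
      (1 + d * Q.support.card) ^ ideg 𝔭 (s + 1) * archConst 𝔭 s ω₀ ^ (d - 1) *
      skewConst 𝔭 s ω₀ := by positivity
  by_cases hcase : rho ω₀ 𝔭 < normAt ω₀ Q
  · -- `δ = ‖Q‖_ω̄`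
    have hδ : bezoutDelta 𝔭 (s + 1) Q ω₀ = normAt ω₀ Q := if_pos hcase
    have hNpos : 0 < normAt ω₀ Q := lt_of_le_of_lt hρ0 hcase
    have h := R2 (normAt ω₀ Q) hNpos
    have hιN : iabs 𝔭 (s + 1) ω₀ ≤
        normAt ω₀ Q * Real.exp (5 * (m : ℝ) ^ 2 * ideg 𝔭 (s + 1)) :=
      h410.trans (mul_le_mul_of_nonneg_right hcase.le (Real.exp_pos _).le)
    have e1 : condBound 𝔭 s Q d ω₀ (normAt ω₀ Q) = normAt ω₀ Q ^ ideg 𝔭 (s + 1) *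
        (maxNorm Q ^ ideg 𝔭 (s + 1) * 2 ^ (d * ideg 𝔭 (s + 1)) *
          (1 + d * Q.support.card) ^ ideg 𝔭 (s + 1) * archConst 𝔭 s ω₀ ^ (d - 1) *
          (skewConst 𝔭 s ω₀ * iabs 𝔭 (s + 1) ω₀)) := by
      unfold condBound
      rw [show normAt ω₀ Q + d * Q.support.card * normAt ω₀ Q =
        normAt ω₀ Q * (1 + d * Q.support.card) by ring, mul_pow]
      ring
    have e2 : smallBound 𝔭 s Q d ω₀ (normAt ω₀ Q) = normAt ω₀ Q *
        (maxNorm Q ^ ideg 𝔭 (s + 1) * archConst 𝔭 s ω₀ ^ d *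
          (2 ^ d * (1 + d * Q.support.card)) * (Q.support.card : ℝ) ^ (ideg 𝔭 (s + 1) - 1)) := by
      unfold smallBound; ring
    have hbound : max (condBound 𝔭 s Q d ω₀ (normAt ω₀ Q))
        (normAt ω₀ Q ^ ideg 𝔭 (s + 1) * smallBound 𝔭 s Q d ω₀ (normAt ω₀ Q)) ≤
        normAt ω₀ Q ^ ideg 𝔭 (s + 1) * (normAt ω₀ Q * valueConst 𝔭 s Q d ω₀) := by
      rw [e1, e2]
      refine max_le ?_ ?_
      · refine mul_le_mul_of_nonneg_left ?_ (pow_nonneg hN0 _)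
        calc maxNorm Q ^ ideg 𝔭 (s + 1) * 2 ^ (d * ideg 𝔭 (s + 1)) *
              (1 + d * Q.support.card) ^ ideg 𝔭 (s + 1) * archConst 𝔭 s ω₀ ^ (d - 1) *
              (skewConst 𝔭 s ω₀ * iabs 𝔭 (s + 1) ω₀)
            ≤ maxNorm Q ^ ideg 𝔭 (s + 1) * 2 ^ (d * ideg 𝔭 (s + 1)) *
              (1 + d * Q.support.card) ^ ideg 𝔭 (s + 1) * archConst 𝔭 s ω₀ ^ (d - 1) *
              (skewConst 𝔭 s ω₀ *
                (normAt ω₀ Q * Real.exp (5 * (m : ℝ) ^ 2 * ideg 𝔭 (s + 1)))) :=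
              mul_le_mul_of_nonneg_left (mul_le_mul_of_nonneg_left hιN hSC) (by positivity)
          _ = normAt ω₀ Q * (maxNorm Q ^ ideg 𝔭 (s + 1) * 2 ^ (d * ideg 𝔭 (s + 1)) *
              (1 + d * Q.support.card) ^ ideg 𝔭 (s + 1) * archConst 𝔭 s ω₀ ^ (d - 1) *
              skewConst 𝔭 s ω₀ * Real.exp (5 * (m : ℝ) ^ 2 * ideg 𝔭 (s + 1))) := by ring
          _ ≤ normAt ω₀ Q * valueConst 𝔭 s Q d ω₀ :=
              mul_le_mul_of_nonneg_left (le_max_left _ _) hN0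
      · exact mul_le_mul_of_nonneg_left (mul_le_mul_of_nonneg_left (le_max_right _ _) hN0)
          (pow_nonneg hN0 _)
    have h' := h.trans hbound
    rw [hδ]
    exact le_of_mul_le_mul_left h' (pow_pos hNpos _)
  · -- `δ = |𝔭(ω̄)|`
    have hδ : bezoutDelta 𝔭 (s + 1) Q ω₀ = iabs 𝔭 (s + 1) ω₀ := if_neg hcase
    push Not at hcase
    rw [hδ]
    rcases hρ0.eq_or_lt with hρ | hρ
    · -- `ρ = 0`: then `‖Q‖_ω̄ = 0`, `|𝔭(ω̄)| = 0` and `ϰ_ω̄(G) = 0`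
      have hN : normAt ω₀ Q = 0 := le_antisymm (hcase.trans_eq hρ.symm) hN0
      have hι : iabs 𝔭 (s + 1) ω₀ = 0 :=
        le_antisymm (h410.trans (by rw [← hρ, zero_mul])) hι0
      set Y : ℝ := maxNorm Q ^ ideg 𝔭 (s + 1) * archConst 𝔭 s ω₀ ^ d *
        (2 ^ d * (d * Q.support.card)) * (Q.support.card : ℝ) ^ (ideg 𝔭 (s + 1) - 1) with hYdef
      have hY0 : 0 ≤ Y := by positivity
      have hY : ∀ θ, 0 < θ →
          ‖(q : ℂ)‖ ^ ideg 𝔭 (s + 1) * maxNorm (kappa ω₀ (uResultant 𝔭 s d Q₀)) ≤ θ * Y := by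
        intro θ hθ
        have h := R2 θ hθ
        have e1 : condBound 𝔭 s Q d ω₀ θ = 0 := by
          unfold condBound; rw [hι, mul_zero, mul_zero]
        have e2 : smallBound 𝔭 s Q d ω₀ θ = θ * Y := by
          rw [hYdef]; unfold smallBound; rw [hN]; ring
        rw [e1, e2] at h
        have hθD : 0 < θ ^ ideg 𝔭 (s + 1) := pow_pos hθ _
        have h' : θ ^ ideg 𝔭 (s + 1) *
            (‖(q : ℂ)‖ ^ ideg 𝔭 (s + 1) * maxNorm (kappa ω₀ (uResultant 𝔭 s d Q₀))) ≤
            θ ^ ideg 𝔭 (s + 1) * (θ * Y) :=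
          h.trans (max_le (by positivity) le_rfl)
        exact le_of_mul_le_mul_left h' hθD
      have htend : Tendsto (fun θ : ℝ => θ * Y) (𝓝[>] 0) (𝓝 0) := by
        have : Tendsto (fun θ : ℝ => θ * Y) (𝓝 0) (𝓝 (0 * Y)) :=
          (continuous_id.mul continuous_const).tendsto 0
        rw [zero_mul] at this
        exact this.mono_left nhdsWithin_le_nhds
      have hM0 : ‖(q : ℂ)‖ ^ ideg 𝔭 (s + 1) * maxNorm (kappa ω₀ (uResultant 𝔭 s d Q₀)) ≤ 0 :=
        ge_of_tendsto htend (eventually_nhdsWithin_of_forall fun θ hθ => hY θ hθ)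
      have hM0' : ‖(q : ℂ)‖ ^ ideg 𝔭 (s + 1) * maxNorm (kappa ω₀ (uResultant 𝔭 s d Q₀)) = 0 :=
        le_antisymm hM0 (mul_nonneg hqpos.le hMnn)
      rw [hM0', hι, zero_mul]
    · -- `ρ > 0`: `θ ↑ ρ` in the conditional estimate
      have hlim : rho ω₀ 𝔭 ^ ideg 𝔭 (s + 1) *
          (‖(q : ℂ)‖ ^ ideg 𝔭 (s + 1) * maxNorm (kappa ω₀ (uResultant 𝔭 s d Q₀))) ≤
          condBound 𝔭 s Q d ω₀ (rho ω₀ 𝔭) := by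
        have hcont_f : Continuous fun θ : ℝ => θ ^ ideg 𝔭 (s + 1) *
            (‖(q : ℂ)‖ ^ ideg 𝔭 (s + 1) * maxNorm (kappa ω₀ (uResultant 𝔭 s d Q₀))) :=
          (continuous_id.pow _).mul continuous_const
        have hcont_g : Continuous fun θ : ℝ => condBound 𝔭 s Q d ω₀ θ := by
          unfold condBound
          exact ((continuous_const.mul ((continuous_const.add
            (continuous_const.mul continuous_id)).pow _)).mul continuous_const).mul
              continuous_const
        have hmem : rho ω₀ 𝔭 ∈ closure (Set.Ioo 0 (rho ω₀ 𝔭)) := by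
          rw [closure_Ioo hρ.ne]; exact Set.right_mem_Icc.mpr hρ.le
        exact ContinuousWithinAt.closure_le hmem hcont_f.continuousWithinAt
          hcont_g.continuousWithinAt fun θ hθ => R1 θ hθ.1 hθ.2
      have e1 : condBound 𝔭 s Q d ω₀ (rho ω₀ 𝔭) ≤ rho ω₀ 𝔭 ^ ideg 𝔭 (s + 1) *
          (iabs 𝔭 (s + 1) ω₀ * (maxNorm Q ^ ideg 𝔭 (s + 1) * 2 ^ (d * ideg 𝔭 (s + 1)) *
            (1 + d * Q.support.card) ^ ideg 𝔭 (s + 1) * archConst 𝔭 s ω₀ ^ (d - 1) *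
            skewConst 𝔭 s ω₀)) := by
        unfold condBound
        have hle : normAt ω₀ Q + d * Q.support.card * rho ω₀ 𝔭 ≤
            rho ω₀ 𝔭 * (1 + d * Q.support.card) := by
          calc normAt ω₀ Q + d * Q.support.card * rho ω₀ 𝔭
              ≤ rho ω₀ 𝔭 + d * Q.support.card * rho ω₀ 𝔭 := add_le_add hcase le_rfl
            _ = rho ω₀ 𝔭 * (1 + d * Q.support.card) := by ring
        have hpow : (normAt ω₀ Q + d * Q.support.card * rho ω₀ 𝔭) ^ ideg 𝔭 (s + 1) ≤
            rho ω₀ 𝔭 ^ ideg 𝔭 (s + 1) * (1 + d * Q.support.card) ^ ideg 𝔭 (s + 1) := by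
          rw [← mul_pow]
          exact pow_le_pow_left₀ (by positivity) hle _
        calc maxNorm Q ^ ideg 𝔭 (s + 1) * 2 ^ (d * ideg 𝔭 (s + 1)) *
              (normAt ω₀ Q + d * Q.support.card * rho ω₀ 𝔭) ^ ideg 𝔭 (s + 1) *
              archConst 𝔭 s ω₀ ^ (d - 1) * (skewConst 𝔭 s ω₀ * iabs 𝔭 (s + 1) ω₀)
            ≤ maxNorm Q ^ ideg 𝔭 (s + 1) * 2 ^ (d * ideg 𝔭 (s + 1)) *
              (rho ω₀ 𝔭 ^ ideg 𝔭 (s + 1) * (1 + d * Q.support.card) ^ ideg 𝔭 (s + 1)) *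
              archConst 𝔭 s ω₀ ^ (d - 1) * (skewConst 𝔭 s ω₀ * iabs 𝔭 (s + 1) ω₀) := by
              refine mul_le_mul_of_nonneg_right (mul_le_mul_of_nonneg_right
                (mul_le_mul_of_nonneg_left hpow (by positivity)) (pow_nonneg hAC _))
                (mul_nonneg hSC hι0)
          _ = _ := by ring
      have h2 := hlim.trans e1
      have h3 := le_of_mul_le_mul_left h2 (pow_pos hρ _)
      refine h3.trans (mul_le_mul_of_nonneg_left ?_ hι0)
      calc maxNorm Q ^ ideg 𝔭 (s + 1) * 2 ^ (d * ideg 𝔭 (s + 1)) *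
            (1 + d * Q.support.card) ^ ideg 𝔭 (s + 1) * archConst 𝔭 s ω₀ ^ (d - 1) *
            skewConst 𝔭 s ω₀
          ≤ maxNorm Q ^ ideg 𝔭 (s + 1) * 2 ^ (d * ideg 𝔭 (s + 1)) *
            (1 + d * Q.support.card) ^ ideg 𝔭 (s + 1) * archConst 𝔭 s ω₀ ^ (d - 1) *
            skewConst 𝔭 s ω₀ * Real.exp (5 * (m : ℝ) ^ 2 * ideg 𝔭 (s + 1)) :=
            le_mul_of_one_le_right hKI0 (Real.one_le_exp (by positivity))
        _ ≤ valueConst 𝔭 s Q d ω₀ := le_max_left _ _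

end Value

end Nesterenko

end Literature.NumberTheory.Transcendental

end
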